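import Summits.QuantumFields.BalabanUV.T4Continuum.Support.ShellMeasureLinearizedGammaTEnd
import Summits.QuantumFields.BalabanUV.T4Continuum.Support.ShellMeasureAverageIterateRegular

/-!
# `T4Continuum.ShellMeasureLinearizedGammaTTower` — W-d's ONE END DECLARATION (`realForm_chartData_gammaT_explicit`,
# row S52) FIRES (§1) AT THE FLAT BACKGROUND and (§2) AT EVERY LEVEL `j ≤ k` OF THE PLAIN AVERAGING TOWER `Ū₀ʲ` OF A
# (52)-REGULAR UNITARY START (S52 × S59), with (§3) the thresholds JOINTLY SATISFIABLE for every `d`, every `L ≥ 2`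
(cell `pub-balaban`, sub-cell `t4`, spine estimate NE7c (node U5b); NE7c ROUND-2 crew `t4-ne7c-formalise-*`, seat
`b2b-balaban-t4-ne7c-formalise-leaf-09` gen 10, OFFER∕CLAIM journal l.14406; ADDITIVE — imports S52 f2
`ShellMeasureLinearizedGammaTEnd` (p219653) and S59 `ShellMeasureAverageIterateRegular` (p219864) ONLY; [folklore];
0 def, 0 `def … : Prop`, 0 cite, 0 sorry)

HONEST FRAMING.  Finite four-torus programme, rung (B)+1 only — NOT infinite volume, NOT a mass gap, NOT the Clay
problem, NOT summit progress; (B), `BetaPertHyp`, (B^μ) are not consumed.  NE7c (`T4IndicatorShell.ShellWeightBound`)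
is NOT PRINTED and NOT PROVED; «NE7c ⇐ the named binders».  THIS FILE REMOVES NO WALL BINDER: Bałaban's step-`k`
background `V⁽ᵏ⁾` ∕ `U_k` (B12 (2.1)–(2.4)) is NOT the plain `k`-fold average of the initial field, and its regularity
(B11 (19)–(21) ∕ B14 (2.16)–(2.17) TYPE) stays DISPLAYED — crew referee DV-26: every W-d headline reads «(Q1)–(Q4)
kernel UNDER the regularity binder», never «p. 267 linearization proved».  What is shown is CONSUMER-SIDE
NON-VACUITY of W-d's one END declaration `ShellMeasureLinearizedGammaT.realForm_chartData_gammaT_explicit` (row S52,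
p219653): its seven hypotheses (`V` unitary; `‖V b‖, ‖(V b)⁻¹‖ ≤ 1`; `0 ≤ ε ≤ 1∕8`; off-axis block loops of EVERY coarse
bond within `ε` of `1`; the Neumann budget `(Lᵈ∕L)·24ε < 1`) are JOINTLY INHABITED — at the flat configuration, and
along the whole plain b07 tower `Ū₀ʲ = uncurry (B7Prop2Explicit.avgIter L (curry U₀) j)`, `j ≤ k` (= S57's
`ShellMeasureAverageIteratePower.avgIter L U₀ j` by S59 `iterate_eq_uncurry_avgIter`), from print's (52) on `U₀`,
unitarity, b07's thresholds `C₀α₀ ≤ ⅓`, `2α₀ ≤ c₂′` and ONE more explicit smallness of `α₀` (the budget).  Nothing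
printed is asserted; [Balaban1985Averaging] Prop. 2 (52)–(54) p. 26 enters only through S59's theorems BY NAME.
HONEST DEPENDENCY (cell): continuum YM on T⁴ ⇐ BetaPertH ∧ nine spine estimates (0/9 proved); BetaPertH ⇐ (D1) ∧
(D4) ∧ CAP+tail; G-an2-4 gates asym, D1 and NE2/3/4.

## What is proved (all [folklore])

* §1 `flat_unitary`, **`flat_regime`**: at `V ≡ 1`, `ε = 0`, every `L`, `d`, C⋆-algebra `𝔸`, the seven hypotheses hold
  (`B12AverageCorridor267.flat_hypotheses` + unitarity of `1`); `example`: the END fires at the flat background.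
* §2 for `U₀ : ZdEdge d → 𝔸ˣ` UNITARY-valued with (52) `pdev (curry U₀) < α₀·(Lᵏ)⁻²`, `0 < α₀`, `C₀α₀ ≤ ⅓`,
  `2α₀ ≤ c₂′(d,L)`, `2 ≤ L`: at every level `j ≤ k` — `level_unitary` (`Ū₀ʲ` unitary-valued: S59 `mem_level` in the
  unitary `AvgClosed` group), **`level_loops_le`** (EVERY off-axis block loop of EVERY coarse bond within
  `ε(α₀) := 32(d+1)(d+4)L²α₀` of `1`: S59 `loop_level_le` × `pdev_level_lt_two_alpha`), `eps_le_one_32`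
  (`ε(α₀) ≤ 1∕32 ≤ 1∕8`, from «`2α₀ ≤ c₂′`»), **`tower_regime`** (the seven hypotheses at level `j` with that ONE `ε(α₀)`,
  the budget from the explicit smallness `hbud : (Lᵈ∕L)·24·ε(α₀) < 1`); `example`: the END fires at level `j`.
* §3 **`tower_thresholds`**: for every `d` and every `2 ≤ L`, `α₀ := 1∕(50000·(d+1)²(d+4)²·L^{d+2})` meets `0 < α₀`,
  `C₀α₀ ≤ ⅓` (`C₀ = 14464(d+1)²(d+4)²`), `2α₀ ≤ c₂′(d,L)` and `(Lᵈ∕L)·24·ε(α₀) < 1` simultaneously; `pdev_flat_lt`: the flat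
  start meets (52) for every `k` — so §2 is non-vacuous at every `d`, `L ≥ 2`, `k`.

WHAT THIS DOES NOT DO.  Anything about Bałaban's `V⁽ᵏ⁾`∕`U_k`; the [dict] residual of W-d (node O); torus ∕ centred
cubes (ℤᵈ corner cubes inherited, D-b12g20.1); the contour-pair average (0.4); NE7c NOT proved; 0∕9 spine.
-/

noncomputable section

open Set Metric

namespace Summit.QuantumFields.BalabanUV.T4Continuum.ShellMeasureLinearizedGammaTTower

open Literature.MathematicalPhysics.QuantumFieldTheory.Balaban1983to89
open Literature.MathematicalPhysics.QuantumLattice (ZdEdge)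
open B7BlockGeometry (qppBonds)
open B7Prop1Explicit (hol plaqWord)
open B7Prop2Explicit (avgIter pdev pdev_nonneg C0 c2' unitaryUnits mem_unitaryUnits avgClosed_unitaryUnits)
open B12HOperator267 (gammaT)
open B12AverageCorridor267 (loopW offAxis mem_blockSites_of_mem_offAxis flat_hypotheses)
open ShellMeasureAverageIterateRegular (mem_level norm_level_le_one norm_level_inv_le_one loop_level_le
  pdev_level_lt_two_alpha)
open ShellMeasureLinearizedGammaT (realForm_chartData_gammaT_explicit)

variable {d : ℕ}

/-! ## §1 The flat background -/

section Flat

variable {𝔸 : Type*} [NormedRing 𝔸] [NormOneClass 𝔸] [StarRing 𝔸]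

omit [NormOneClass 𝔸] in
/-- The flat configuration is unitary-valued. [folklore] -/
theorem flat_unitary (b : ZdEdge d) : (((1 : ZdEdge d → 𝔸ˣ) b : 𝔸ˣ) : 𝔸) ∈ unitary 𝔸 := by
  rw [Pi.one_apply, Units.val_one]
  exact Submonoid.one_mem _

/-- **THE SEVEN HYPOTHESES OF W-d's END AT THE FLAT BACKGROUND** (`V ≡ 1`, `ε = 0`; every `L`, `d`, `𝔸`): unitarity,
the two unit bounds, `0 ≤ 0 ≤ 1∕8`, all off-axis block loops EQUAL to `1`, and the budget `(Lᵈ∕L)·24·0 < 1`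
(`B12AverageCorridor267.flat_hypotheses` + `flat_unitary`). [folklore] -/
theorem flat_regime (L : ℕ) :
    (∀ b, (((1 : ZdEdge d → 𝔸ˣ) b : 𝔸ˣ) : 𝔸) ∈ unitary 𝔸) ∧
    (∀ b, ‖(((1 : ZdEdge d → 𝔸ˣ) b : 𝔸ˣ) : 𝔸)‖ ≤ 1) ∧
    (∀ b, ‖((((1 : ZdEdge d → 𝔸ˣ) b)⁻¹ : 𝔸ˣ) : 𝔸)‖ ≤ 1) ∧
    (0 : ℝ) ≤ 0 ∧ (0 : ℝ) ≤ 1 / 8 ∧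
    (∀ c', ∀ x ∈ offAxis L c',
      ‖((loopW L (fun U : ZdEdge d → 𝔸ˣ => gammaT L U) (1 : ZdEdge d → 𝔸ˣ) c' x : 𝔸ˣ) : 𝔸) - 1‖ ≤ (0 : ℝ)) ∧
    (L : ℝ) ^ d / L * (24 * (0 : ℝ)) < 1 := by
  obtain ⟨hW, hV, hV', hbud⟩ := flat_hypotheses (𝔸 := 𝔸) (d := d) L
  exact ⟨flat_unitary, hV, hV', le_rfl, by norm_num, hW, hbud⟩

end Flat

section FlatEnd

/-- **W-d's END FIRES AT THE FLAT BACKGROUND**: `realForm_chartData_gammaT_explicit` applied at `V ≡ 1`, `ε = 0` — the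
(LR)_j real-form chart data of the printed average [B7] (15) at every coarse bond of the flat configuration, with NO
hypothesis beyond `0 < L` (finite-dimensional C⋆-algebra, Borel structures as in S52). [folklore] -/
example {𝔸 : Type*} [CStarAlgebra 𝔸] [Nontrivial 𝔸] [FiniteDimensional ℂ 𝔸] [MeasurableSpace 𝔸] [BorelSpace 𝔸]
    {L : ℕ} {c : ZdEdge d} [MeasurableSpace (↥(qppBonds L c) → 𝔸)] [BorelSpace (↥(qppBonds L c) → 𝔸)]
    (hL : 0 < L) :=
  realForm_chartData_gammaT_explicit (𝔸 := 𝔸) (c := c) (ε := 0) (V := (1 : ZdEdge d → 𝔸ˣ)) hL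
    (flat_regime (𝔸 := 𝔸) (d := d) L).1 (flat_regime (𝔸 := 𝔸) (d := d) L).2.1
    (flat_regime (𝔸 := 𝔸) (d := d) L).2.2.1 (flat_regime (𝔸 := 𝔸) (d := d) L).2.2.2.1
    (flat_regime (𝔸 := 𝔸) (d := d) L).2.2.2.2.1 (flat_regime (𝔸 := 𝔸) (d := d) L).2.2.2.2.2.1
    (flat_regime (𝔸 := 𝔸) (d := d) L).2.2.2.2.2.2

end FlatEnd

/-! ## §2 The plain averaging tower of a (52)-regular unitary start -/

section Tower

variable {𝔸 : Type*} [CStarAlgebra 𝔸] [Nontrivial 𝔸] {L : ℕ}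

variable (hL : 2 ≤ L) (k : ℕ) (U : ZdEdge d → 𝔸ˣ) (hU : ∀ b, U b ∈ unitaryUnits 𝔸)
  {α₀ : ℝ} (hα : 0 < α₀) (hα3 : C0 d * α₀ ≤ 1 / 3) (hα2 : 2 * α₀ ≤ c2' d L)
  (h52 : pdev (Function.curry U) < α₀ * (((L : ℝ) ^ k)⁻¹) ^ 2)
include hL hU hα hα3 hα2 h52

/-- **BINDER `hVu` AT LEVEL `j ≤ k`:** `Ū₀ʲ` is unitary-valued (S59 `mem_level` in the `AvgClosed` group of unitaries,
`B7Prop2Explicit.avgClosed_unitaryUnits`). [folklore] -/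
theorem level_unitary {j : ℕ} (hj : j ≤ k) (b : ZdEdge d) :
    ((Function.uncurry (avgIter L (Function.curry U) j) b : 𝔸ˣ) : 𝔸) ∈ unitary 𝔸 :=
  mem_unitaryUnits.1 (mem_level hL (avgClosed_unitaryUnits d L) k U hU hα hα3 hα2 h52 hj b)

/-- **BINDER `hW` AT LEVEL `j ≤ k` WITH `ε(α₀) = 32(d+1)(d+4)L²α₀`:** every off-axis block loop of every coarse bond of
`Ū₀ʲ` is within `ε(α₀)` of `1` (S59 `loop_level_le`: `≤ 16(d+1)(d+4)L²·pdev(Ū₀ʲ)`, and `pdev(Ū₀ʲ) < 2α₀`). [folklore] -/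
theorem level_loops_le {j : ℕ} (hj : j ≤ k) (c' : ZdEdge d) {x : Fin d → ℤ} (hx : x ∈ offAxis L c') :
    ‖((loopW L (fun U : ZdEdge d → 𝔸ˣ => gammaT L U) (Function.uncurry (avgIter L (Function.curry U) j)) c' x : 𝔸ˣ)
        : 𝔸) - 1‖ ≤ 32 * ((d : ℝ) + 1) * ((d : ℝ) + 4) * (L : ℝ) ^ 2 * α₀ := by
  have h := loop_level_le hL (avgClosed_unitaryUnits d L) k U hU hα hα3 hα2 h52 hj c' (mem_blockSites_of_mem_offAxis hx)
  have hP := pdev_level_lt_two_alpha hL (avgClosed_unitaryUnits d L) k U hU hα hα3 hα2 h52 hj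
  have hK : (0 : ℝ) ≤ 8 * ((d : ℝ) + 1) * ((d : ℝ) + 4) * (L : ℝ) ^ 2 := by positivity
  refine h.trans ?_
  nlinarith [mul_le_mul_of_nonneg_left hP.le hK]

omit hU h52 hα3 hα in
/-- `ε(α₀) ≤ 1∕32` — this IS print's «`2α₀ ≤ c₂′`» (`c₂′ = 1∕(512(d+1)(d+4)L²)`). [folklore] -/
theorem eps_le_one_32 : 32 * ((d : ℝ) + 1) * ((d : ℝ) + 4) * (L : ℝ) ^ 2 * α₀ ≤ 1 / 32 := by
  have hpos : (0 : ℝ) < 512 * ((d : ℝ) + 1) * (d + 4) * (L : ℝ) ^ 2 := by positivity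
  have hc : 2 * α₀ ≤ 1 / (512 * ((d : ℝ) + 1) * (d + 4) * (L : ℝ) ^ 2) := hα2.trans (le_of_eq rfl)
  rw [le_div_iff₀ hpos] at hc
  nlinarith

omit hL hU h52 hα3 hα2 in
/-- `0 ≤ ε(α₀)`. [folklore] -/
theorem eps_nonneg : 0 ≤ 32 * ((d : ℝ) + 1) * ((d : ℝ) + 4) * (L : ℝ) ^ 2 * α₀ := by positivity

/-- **THE SEVEN HYPOTHESES OF W-d's END AT LEVEL `j ≤ k` OF THE TOWER**, with the ONE `ε(α₀) = 32(d+1)(d+4)L²α₀` for all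
levels, from (52) on `U₀`, unitarity, `C₀α₀ ≤ ⅓`, `2α₀ ≤ c₂′`, and the explicit budget smallness
`hbud : (Lᵈ∕L)·24·ε(α₀) < 1`. [folklore] -/
theorem tower_regime (hbud : (L : ℝ) ^ d / L * (24 * (32 * ((d : ℝ) + 1) * ((d : ℝ) + 4) * (L : ℝ) ^ 2 * α₀)) < 1)
    {j : ℕ} (hj : j ≤ k) :
    (∀ b, ((Function.uncurry (avgIter L (Function.curry U) j) b : 𝔸ˣ) : 𝔸) ∈ unitary 𝔸) ∧
    (∀ b, ‖((Function.uncurry (avgIter L (Function.curry U) j) b : 𝔸ˣ) : 𝔸)‖ ≤ 1) ∧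
    (∀ b, ‖(((Function.uncurry (avgIter L (Function.curry U) j) b)⁻¹ : 𝔸ˣ) : 𝔸)‖ ≤ 1) ∧
    (0 : ℝ) ≤ 32 * ((d : ℝ) + 1) * ((d : ℝ) + 4) * (L : ℝ) ^ 2 * α₀ ∧
    32 * ((d : ℝ) + 1) * ((d : ℝ) + 4) * (L : ℝ) ^ 2 * α₀ ≤ 1 / 8 ∧
    (∀ c', ∀ x ∈ offAxis L c',
      ‖((loopW L (fun U : ZdEdge d → 𝔸ˣ => gammaT L U) (Function.uncurry (avgIter L (Function.curry U) j)) c' x : 𝔸ˣ)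
          : 𝔸) - 1‖ ≤ 32 * ((d : ℝ) + 1) * ((d : ℝ) + 4) * (L : ℝ) ^ 2 * α₀) ∧
    (L : ℝ) ^ d / L * (24 * (32 * ((d : ℝ) + 1) * ((d : ℝ) + 4) * (L : ℝ) ^ 2 * α₀)) < 1 :=
  ⟨level_unitary hL k U hU hα hα3 hα2 h52 hj,
    norm_level_le_one hL (avgClosed_unitaryUnits d L) k U hU hα hα3 hα2 h52 hj,
    norm_level_inv_le_one hL (avgClosed_unitaryUnits d L) k U hU hα hα3 hα2 h52 hj,
    eps_nonneg hα, (eps_le_one_32 hL hα2).trans (by norm_num),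
    fun c' _ hx => level_loops_le hL k U hU hα hα3 hα2 h52 hj c' hx, hbud⟩

/-- **W-d's END FIRES AT EVERY LEVEL `j ≤ k` OF THE TOWER**: `realForm_chartData_gammaT_explicit` at the background
`Ū₀ʲ` with `ε(α₀)` — the (LR)_j real-form chart data of the printed average exist at every coarse bond of every
averaged background of the plain tower, from (52) on the unitary start `U₀` + the two b07 thresholds + the budget
smallness, with NO per-level regime binder (finite-dimensional C⋆-algebra, Borel structures as in S52). [folklore] -/
example [FiniteDimensional ℂ 𝔸] [MeasurableSpace 𝔸] [BorelSpace 𝔸]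
    {c : ZdEdge d} [MeasurableSpace (↥(qppBonds L c) → 𝔸)] [BorelSpace (↥(qppBonds L c) → 𝔸)]
    (hbud : (L : ℝ) ^ d / L * (24 * (32 * ((d : ℝ) + 1) * ((d : ℝ) + 4) * (L : ℝ) ^ 2 * α₀)) < 1) {j : ℕ}
    (hj : j ≤ k) :=
  realForm_chartData_gammaT_explicit (𝔸 := 𝔸) (c := c) (lt_of_lt_of_le (by norm_num) hL)
    (tower_regime hL k U hU hα hα3 hα2 h52 hbud hj).1 (tower_regime hL k U hU hα hα3 hα2 h52 hbud hj).2.1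
    (tower_regime hL k U hU hα hα3 hα2 h52 hbud hj).2.2.1 (tower_regime hL k U hU hα hα3 hα2 h52 hbud hj).2.2.2.1
    (tower_regime hL k U hU hα hα3 hα2 h52 hbud hj).2.2.2.2.1 (tower_regime hL k U hU hα hα3 hα2 h52 hbud hj).2.2.2.2.2.1
    (tower_regime hL k U hU hα hα3 hα2 h52 hbud hj).2.2.2.2.2.2

end Tower

/-! ## §3 The thresholds are jointly satisfiable; the flat start meets (52) -/

section Thresholds

/-- **JOINT SATISFIABILITY OF THE TOWER's NUMERICS**: for every `d` and every `2 ≤ L`, the explicit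
`α₀ := 1∕(50000·(d+1)²·(d+4)²·L^{d+2})` satisfies `0 < α₀`, b07's `C₀α₀ ≤ ⅓` (`C₀ = 226·(8(d+1)(d+4))²`) and
`2α₀ ≤ c₂′(d,L) = 1∕(512(d+1)(d+4)L²)`, and the budget smallness `(Lᵈ∕L)·24·(32(d+1)(d+4)L²α₀) < 1`
(`= 768∕(50000(d+1)(d+4)L) < 1`). [folklore] -/
theorem tower_thresholds (d : ℕ) {L : ℕ} (hL : 2 ≤ L) :
    0 < 1 / (50000 * ((d : ℝ) + 1) ^ 2 * ((d : ℝ) + 4) ^ 2 * (L : ℝ) ^ (d + 2)) ∧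
    C0 d * (1 / (50000 * ((d : ℝ) + 1) ^ 2 * ((d : ℝ) + 4) ^ 2 * (L : ℝ) ^ (d + 2))) ≤ 1 / 3 ∧
    2 * (1 / (50000 * ((d : ℝ) + 1) ^ 2 * ((d : ℝ) + 4) ^ 2 * (L : ℝ) ^ (d + 2))) ≤ c2' d L ∧
    (L : ℝ) ^ d / L * (24 * (32 * ((d : ℝ) + 1) * ((d : ℝ) + 4) * (L : ℝ) ^ 2 *
      (1 / (50000 * ((d : ℝ) + 1) ^ 2 * ((d : ℝ) + 4) ^ 2 * (L : ℝ) ^ (d + 2))))) < 1 := by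
  have hLr : (2 : ℝ) ≤ L := by exact_mod_cast hL
  have hL1 : (1 : ℝ) ≤ L := by linarith
  have hL0 : (0 : ℝ) < L := by linarith
  have hd0 : (0 : ℝ) ≤ d := Nat.cast_nonneg d
  have hd1 : (1 : ℝ) ≤ (d : ℝ) + 1 := by linarith
  have hd4 : (4 : ℝ) ≤ (d : ℝ) + 4 := by linarith
  have hLd : (1 : ℝ) ≤ (L : ℝ) ^ d := one_le_pow₀ hL1
  have hLd2 : (L : ℝ) ^ (d + 2) = (L : ℝ) ^ d * (L : ℝ) ^ 2 := by rw [pow_add]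
  set D : ℝ := 50000 * ((d : ℝ) + 1) ^ 2 * ((d : ℝ) + 4) ^ 2 * (L : ℝ) ^ (d + 2) with hD
  have hDpos : 0 < D := by positivity
  refine ⟨by positivity, ?_, ?_, ?_⟩
  · -- `C₀·α₀ = 226·64(d+1)²(d+4)² ∕ D ≤ 14464 ∕ 50000 ≤ 1∕3`
    rw [C0, mul_one_div, div_le_iff₀ hDpos, hD, hLd2]
    have h1 : (1 : ℝ) ≤ (L : ℝ) ^ d * (L : ℝ) ^ 2 := by nlinarith
    nlinarith [mul_nonneg (mul_nonneg (by norm_num : (0:ℝ) ≤ 226) (sq_nonneg (8 * ((d : ℝ) + 1) * ((d : ℝ) + 4))))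
      (sub_nonneg.2 h1), sq_nonneg (((d : ℝ) + 1) * ((d : ℝ) + 4))]
  · -- `2α₀ ≤ c₂′`: `2·512(d+1)(d+4)L² ≤ D`
    rw [c2', mul_one_div, div_le_div_iff₀ hDpos (by positivity), one_mul, hD, hLd2]
    have h2 : (512 : ℝ) * ((d : ℝ) + 1) * (d + 4) * (L : ℝ) ^ 2 ≤
        512 * ((d : ℝ) + 1) * (d + 4) * (L : ℝ) ^ 2 * ((L : ℝ) ^ d * (((d : ℝ) + 1) * ((d : ℝ) + 4))) := by
      have : (1 : ℝ) ≤ (L : ℝ) ^ d * (((d : ℝ) + 1) * ((d : ℝ) + 4)) := by nlinarith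
      nlinarith [mul_nonneg (mul_nonneg (mul_nonneg (by norm_num : (0:ℝ) ≤ 512) (by linarith : (0:ℝ) ≤ (d:ℝ) + 1))
        (by linarith : (0:ℝ) ≤ (d:ℝ) + 4)) (sq_nonneg (L : ℝ)), this]
    nlinarith [h2, mul_nonneg (mul_nonneg (by linarith : (0:ℝ) ≤ (d:ℝ) + 1) (by linarith : (0:ℝ) ≤ (d:ℝ) + 4))
      (mul_nonneg (pow_nonneg hL0.le d) (sq_nonneg (L : ℝ)))]
  · -- budget: `(Lᵈ∕L)·24·32(d+1)(d+4)L²∕D = 768 ∕ (50000(d+1)(d+4)L) < 1`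
    have hval : (L : ℝ) ^ d / L * (24 * (32 * ((d : ℝ) + 1) * ((d : ℝ) + 4) * (L : ℝ) ^ 2 * (1 / D))) =
        768 / (50000 * ((d : ℝ) + 1) * ((d : ℝ) + 4) * L) := by
      rw [hD, hLd2]
      field_simp
      ring
    rw [hval, div_lt_one (by positivity)]
    nlinarith [mul_le_mul hd1 hd4 (by norm_num) (by linarith), hLr]

/-- Every parallel transport of the flat configuration is `1`. [folklore] -/
theorem hol_flat {G : Type*} [Group G] (x : Fin d → ℤ) (w : List (B7Prop1Explicit.Letter d)) :
    hol (fun (_ : Fin d → ℤ) (_ : Fin d) => (1 : G)) x w = 1 :=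
  Subgroup.mem_bot.1 (B7Prop2Explicit.hol_mem_of (S := (⊥ : Subgroup G)) (fun _ _ => Subgroup.mem_bot.2 rfl) x w)

variable {𝔸 : Type*} [NormedRing 𝔸]

/-- The flat configuration has plaquette deviation `0`. [folklore] -/
theorem pdev_flat : pdev (Function.curry (1 : ZdEdge d → 𝔸ˣ)) = 0 := by
  have h1 : Function.curry (1 : ZdEdge d → 𝔸ˣ) = fun (_ : Fin d → ℤ) (_ : Fin d) => (1 : 𝔸ˣ) := rfl
  refine le_antisymm ?_ (pdev_nonneg _)
  unfold pdev
  refine Real.iSup_le (fun p => ?_) le_rfl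
  rw [h1, hol_flat, Units.val_one, sub_self, norm_zero]

/-- **THE FLAT START MEETS (52) AT EVERY RESOLUTION**: `pdev (curry 1) = 0 < α₀·(Lᵏ)⁻²` for `0 < α₀`, `0 < L`. [folklore] -/
theorem pdev_flat_lt {L : ℕ} (hL : 0 < L) (k : ℕ) {α₀ : ℝ} (hα : 0 < α₀) :
    pdev (Function.curry (1 : ZdEdge d → 𝔸ˣ)) < α₀ * (((L : ℝ) ^ k)⁻¹) ^ 2 := by
  rw [pdev_flat]
  have hL0 : (0 : ℝ) < L := by exact_mod_cast hL
  positivity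

end Thresholds

end Summit.QuantumFields.BalabanUV.T4Continuum.ShellMeasureLinearizedGammaTTower

end
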